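import Literature.Computability.MetaComplexity.MagnificationFrontiers
import HarnessLib

/-!
# Discharge (vacuous) of the HM-frontier lower-bound facts B4 / C4 — the tree's `FORMULA s` is empty

Companion to `MagnificationFrontiers.lean` (Chen–Hirahara–Oliveira–Pich–Rajgopal–Santhanam,
arXiv:1911.08297, §1.1, items B4 and C4: `MCSP[2^{n^{1/3}}, 2^{n^{2/3}}] ∉ Formula[N^{1.99}]`,
`MCSP[2^{√n}/10n, 2^{√n}] ∉ Formula[N^{1.99}]`, after [HS17], [OPS19]).

**What is proved here and why it is NOT the printed theorem.** The named facts
`chop_frontierB4` / `chop_frontierC4` say `gapMCSP a b ∉ promiseLift frontierFormulaClass` with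
`frontierFormulaClass = FORMULA (N ↦ ⌊N^{1.99}⌋₊ - 1)`. But the class `FORMULA s`
(`Magnification.lean`) is EMPTY for every `s` (`FORMULA_eq_empty`): membership asks for a
De Morgan formula `C 0 : Circuit (Fin 0)` at input length `0`, and there is no circuit over
`deMorganBasis = {∧₂, ∨₂, ¬}` on an empty variable set — the first gate of a circuit without
inputs must have arity `0` (`Circuit.wf` forbids back-references from gate `0`), every De Morgan
gate has arity `1` or `2`, and a gate-free circuit has no admissible output wire
(`not_isOver_deMorganBasis_of_isEmpty`). Hence `promiseLift frontierFormulaClass = ∅` and both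
facts hold VACUOUSLY (`chop_frontierB4_holds`, `chop_frontierC4_holds`): the discharges below
carry no lower-bound content whatsoever. The genuine content of B4/C4 — for all large `n`, every
De Morgan formula separating the YES- from the NO-instances of length `N = 2ⁿ` has more than
`N^{1.99}` leaves (HS17 via pseudorandom shrinkage; CHOPRS Thm. 59) — is re-vendored length-wise
as the named fact `chop_frontierB4_ae` (file `MagnificationFrontiersAE.lean`), unproved.

## References

* L. Chen, S. Hirahara, I. C. Oliveira, J. Pich, N. Rajgopal, R. Santhanam, *Beyond natural
  proofs: hardness magnification and locality*, arXiv:1911.08297 (ITCS 2020), §1.1 (B4, C4),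
  §5.2.2 / Thm. 59 (localisation of the HS17 lower bound).
* S. Hirahara, R. Santhanam, CCC 2017 ([HS17]); I. C. Oliveira, J. Pich, R. Santhanam, CCC 2019
  ([OPS19]).
-/

namespace Literature.Computability.MetaComplexity

open Literature.Computability.Complexity

/-! ### No De Morgan circuit on an empty variable set; `FORMULA s = ∅` -/

/-- Over an EMPTY set of input variables there is no circuit over the De Morgan basis
`{∧₂, ∨₂, ¬}`: the first gate of a circuit without inputs has arity `0` (no input wires exist and
`Circuit.wf` forbids back-references), but every De Morgan gate has arity `1` or `2`; and a
circuit without gates has no admissible output wire. [folklore] -/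
theorem not_isOver_deMorganBasis_of_isEmpty {ι : Type*} [IsEmpty ι] (C : Circuit ι) :
    ¬ C.IsOver deMorganBasis := by
  obtain ⟨gates, output, wf, wf_output⟩ := C
  intro hC
  cases gates with
  | nil =>
    cases output with
    | inl i => exact isEmptyElim i
    | inr m => exact absurd (wf_output m rfl) (by simp)
  | cons g rest =>
    have hfn : g.fn ∈ deMorganBasis := hC g List.mem_cons_self
    have harity : 0 < g.arity := by
      simp only [deMorganBasis, Set.mem_insert_iff, Set.mem_singleton_iff] at hfn
      rcases hfn with h | h | h <;>
      · have h1 := congrArg Sigma.fst h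
        simp only [Gate.fn, GateFn.and, GateFn.or, GateFn.not] at h1
        omega
    have h0 : 0 < (g :: rest).length := by simp
    cases ha : g.args ⟨0, harity⟩ with
    | inl i => exact isEmptyElim i
    | inr m => exact absurd (wf 0 h0 ⟨0, harity⟩ m ha) (Nat.not_lt_zero m)

/-- **`FORMULA s = ∅` for every size bound `s`.** The class asks for a De Morgan formula at EVERY
input length including `0`, and there is no De Morgan circuit on `Fin 0`
(`not_isOver_deMorganBasis_of_isEmpty`). Hence every statement `… ∉ FORMULA s` /
`… ∉ promiseLift (FORMULA s)` in the tree is vacuous, and every `… ∈ FORMULA s` is false.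
[folklore] -/
theorem FORMULA_eq_empty (s : ℕ → ℕ) : FORMULA s = ∅ := by
  ext L
  simp only [Set.mem_empty_iff_false, iff_false]
  rintro ⟨C, hC, -⟩
  exact not_isOver_deMorganBasis_of_isEmpty (C 0) (hC 0).1

/-- In particular the frontier class `FORMULA (N ↦ ⌊N^{1.99}⌋₊ - 1)` is empty. [folklore] -/
theorem frontierFormulaClass_eq_empty : frontierFormulaClass = ∅ :=
  FORMULA_eq_empty _

/-- The promise lift of the empty class is empty. [folklore] -/
theorem promiseLift_empty : promiseLift (∅ : Set (Language Bool)) = ∅ := by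
  ext Q
  simp [promiseLift]

/-- No promise problem at all lies in `promiseLift frontierFormulaClass` (the class is empty).
[folklore] -/
theorem not_mem_promiseLift_frontierFormulaClass (Q : PromiseProblem) :
    Q ∉ promiseLift frontierFormulaClass := by
  rw [frontierFormulaClass_eq_empty, promiseLift_empty]
  exact Set.notMem_empty Q

/-! ### The discharges (vacuous — see the module docstring) -/

/-- DISCHARGE of `chop_frontierB4` (CHOPRS 2019, §1.1, item B4:
`MCSP[2^{n^{1/3}}, 2^{n^{2/3}}] ∉ Formula[N^{1.99}]`). **Vacuous**: the tree's class
`frontierFormulaClass` is empty (`FORMULA_eq_empty`), so nothing lies in its promise lift. This is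
NOT a formalisation of the Hirahara–Santhanam lower bound; the faithful length-wise statement is
the named fact `chop_frontierB4_ae`. [cite: arXiv191108297, §1.1 (B4)] -/
theorem chop_frontierB4_holds : chop_frontierB4 :=
  not_mem_promiseLift_frontierFormulaClass _

/-- DISCHARGE of `chop_frontierC4` (CHOPRS 2019, §1.1, item C4:
`MCSP[2^{√n}/10n, 2^{√n}] ∉ Formula[N^{1.99}]`). **Vacuous** for the same reason as
`chop_frontierB4_holds` (`FORMULA_eq_empty`); the faithful length-wise statement is the named fact
`chop_frontierC4_ae`. [cite: arXiv191108297, §1.1 (C4)] -/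
theorem chop_frontierC4_holds : chop_frontierC4 :=
  not_mem_promiseLift_frontierFormulaClass _

end Literature.Computability.MetaComplexity
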